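import Mathlib.Algebra.Order.Monoid.TypeTags
import Mathlib.Algebra.Group.TypeTags.Hom
import Mathlib.Algebra.Order.Ring.Rat
import Mathlib.Tactic.Linarith
import Mathlib.Tactic.Ring
import Mathlib.Tactic.Positivity
import Literature.IUT.HodgeArakelov.TemperedThetaMonoidsProofs

/-!
# [IUTchII] §3, Prop 3.1 / Ex 3.2 — NON-VACUITY WITNESS for the interfaces of
# `TemperedThetaMonoids.lean`

S. Mochizuki, *Inter-universal Teichmüller theory II*, §3, Proposition 3.1 (pp. 87–88) and Example
3.2 (pp. 88–89) of the kurims Dec-2020 manuscript [cite: Mochizuki2012, Prop 3.1 p.87]. Claim key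
DISPUTED (D-0012); PROOF-ONLY file (abc-iut cell, layer L6, wave-3 discharge seat abc-iut-L6-d3,
DISCHARGE BOARD item M6). Nothing here asserts a disputed claim or takes a side on [IUTchIII] Cor
3.12, and nothing here models an actual mono-theta environment: the file only shows that the
`Prop`-valued statement structures `Prop31Statements` / `Example32Statements` of the statement file
(typed over the interfaces `ThetaEnvData`, `TemperedFrobenioidThetaData`) are satisfied by
NON-DEGENERATE data — a non-torsion theta class, a family of theta subsets genuinely PERMUTED by
the group action, non-torsion units — so that a soundness audit cannot read them as vacuous or as
constraining only degenerate inputs (RQ7 vocabulary: not VACUOUS-BY-STUB). The toy is the standard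
"units × order" caricature of `O^×(T^÷_{A^Θ_∞}) ⊇ O^×_{C^Θ_v}(A^Θ_∞) · Θ_v^ℕ`: the group `ℚ × ℚ` (written
multiplicatively), first coordinate = "unit part", second coordinate = "order of the divisor",
units `U = ℚ × 0`, constants `= {order ≥ 0}`, theta classes `θ_k = (k, 1)` and their `N`-th roots
`(k/N, 1/N)`, indexed by `k ∈ ℤ` (cf. the `l·ℤ`-torsor of inversion automorphisms `ι`), and the group
`ℤ` acting by the shears `(a, b) ↦ (a + n b, b)` — which fix the units, preserve the order, and
translate the index `k ↦ k + n`. The statement structures then hold by the companion's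
`prop31Statements_of_val` / `example32Statements_of_val` with the divisor map = second projection.
Existential THEOREMS only (no definitions land in the tree).
-/

namespace Literature.IUT.HodgeArakelov

namespace TemperedThetaMonoids

open Multiplicative

/-- The shear action of `ℤ` on `ℚ × ℚ`, `n · (a, b) = (a + n b, b)`, as a homomorphism
`Multiplicative ℤ →* MulAut (Multiplicative (ℚ × ℚ))` (toy conjugation action for the witnesses below).
[folklore] -/
private theorem exists_shear :
    ∃ σ : Multiplicative ℤ →* MulAut (Multiplicative (ℚ × ℚ)),
      ∀ (g : Multiplicative ℤ) (x : Multiplicative (ℚ × ℚ)),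
        toAdd (σ g x) = ((toAdd x).1 + ((toAdd g : ℤ) : ℚ) * (toAdd x).2, (toAdd x).2) := by
  let sh : ℤ → MulAut (Multiplicative (ℚ × ℚ)) := fun n =>
    { toFun := fun x => ofAdd ((toAdd x).1 + (n : ℚ) * (toAdd x).2, (toAdd x).2)
      invFun := fun x => ofAdd ((toAdd x).1 - (n : ℚ) * (toAdd x).2, (toAdd x).2)
      left_inv := fun x => by
        apply toAdd.injective
        ext <;> simp
      right_inv := fun x => by
        apply toAdd.injective
        ext <;> simp
      map_mul' := fun x y => by
        apply toAdd.injective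
        ext <;> simp [toAdd_mul, mul_add, add_assoc, add_left_comm] }
  refine ⟨{ toFun := fun g => sh (toAdd g), map_one' := ?_, map_mul' := ?_ }, ?_⟩
  · apply MulEquiv.ext
    intro x
    apply toAdd.injective
    ext <;> simp [sh]
  · intro g h
    apply MulEquiv.ext
    intro x
    apply toAdd.injective
    ext <;> simp [sh, MulAut.mul_apply, toAdd_mul, add_mul, add_comm, add_left_comm]
  · intro g x
    rfl

/-- **IUTchII:Prop3.1(i)**/(ii) (kurims pp.87–88) NON-VACUITY WITNESS: there is a `ThetaEnvData`
(group `ℤ` acting on `ℚ × ℚ` by shears; units `ℚ × 0`; constants `{order ≥ 0}`; theta classes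
`θ_k = (k, 1)` with all their `N`-th roots, `k ∈ ℤ`) for which the statement structure
`Prop31Statements` HOLDS while (a) every theta class is NON-torsion, (b) the action genuinely
PERMUTES the theta subsets (`θ_k ↦ θ_{k+n}`), and (c) there are non-torsion units — so the typed
clauses (conjugation action permuting `{Ψ^ι_env}_ι`, splittings up to torsion, stability of `Ψ_cns`) are
jointly satisfiable by non-degenerate data. [cite: Mochizuki2012, Prop 3.1 p.87] -/
theorem prop31Statements_witness :
    ∃ E : ThetaEnvData.{0, 0} (Multiplicative ℤ),
      Prop31Statements E ∧
      (∀ ι : E.Iota, ∃ t ∈ E.thetaEnv ι, ¬ IsOfFinOrder t) ∧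
      (∃ (g : Multiplicative ℤ) (ι : E.Iota), E.conj g '' E.thetaEnv ι ≠ E.thetaEnv ι) ∧
      (∃ u ∈ E.units, ¬ IsOfFinOrder u) := by
  obtain ⟨σ, hσ⟩ := exists_shear
  -- divisor map (second projection) and "unit part" (first projection)
  let v : Multiplicative (ℚ × ℚ) →* Multiplicative ℚ := (AddMonoidHom.snd ℚ ℚ).toMultiplicative
  let w : Multiplicative (ℚ × ℚ) →* Multiplicative ℚ := (AddMonoidHom.fst ℚ ℚ).toMultiplicative
  have hv : ∀ x : Multiplicative (ℚ × ℚ), toAdd (v x) = (toAdd x).2 := fun _ => rfl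
  have hσ2 : ∀ (g : Multiplicative ℤ) (x : Multiplicative (ℚ × ℚ)), (toAdd (σ g x)).2 = (toAdd x).2 :=
    fun g x => by rw [hσ g x]
  -- the constant monoid `{order ≥ 0}`
  let C : Submonoid (Multiplicative (ℚ × ℚ)) :=
    { carrier := {x | 0 ≤ (toAdd x).2}
      one_mem' := by simp
      mul_mem' := fun {x y} hx hy => by
        simp only [Set.mem_setOf_eq, toAdd_mul, Prod.snd_add] at hx hy ⊢
        linarith }
  refine ⟨{ H := CommGrpCat.of (Multiplicative (ℚ × ℚ))
            conj := σ
            Iota := ℤ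
            units := v.ker
            constants := C
            units_eq := ?_
            thetaEnv := fun k => ({ofAdd ((k : ℚ), (1 : ℚ))} : Set (Multiplicative (ℚ × ℚ)))
            inftyThetaEnv := fun k =>
              ({x : Multiplicative (ℚ × ℚ) |
                  ∃ N : ℕ, 0 < N ∧ toAdd x = ((k : ℚ) / N, 1 / (N : ℚ))} : Set (Multiplicative (ℚ × ℚ)))
            theta_subset := ?_ }, ?_, ?_, ?_, ?_⟩
  · -- `M^×_TM` is the group of units of `M_TM`: order `= 0` iff order `≥ 0` and `≤ 0`
    intro (x : Multiplicative (ℚ × ℚ))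
    have e : x ∈ v.ker ↔ (toAdd x).2 = 0 := by
      rw [MonoidHom.mem_ker, ← toAdd.injective.eq_iff, hv, toAdd_one]
    rw [e]
    change (toAdd x).2 = 0 ↔ 0 ≤ (toAdd x).2 ∧ 0 ≤ (toAdd x⁻¹).2
    rw [toAdd_inv, Prod.snd_neg]
    constructor
    · intro h; constructor <;> linarith
    · rintro ⟨h₁, h₂⟩; linarith
  · -- `θ_k ∈ ∞θ_k` (take `N = 1`)
    intro k
    rintro _ ⟨rfl⟩
    exact ⟨1, Nat.one_pos, by simp⟩
  · -- `Prop31Statements` from the companion's assembly theorem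
    refine prop31Statements_of_val _ (Γ := Multiplicative ℚ) ?_ ?_ v ?_ ?_
    · -- the constant monoid is stable: shears preserve the order
      intro g x hx
      change 0 ≤ (toAdd (σ g x)).2
      rw [hσ2]
      exact hx
    · -- the action permutes the theta subsets: `θ_k ↦ θ_{k + n}`
      intro g k
      refine ⟨k + toAdd g, ?_⟩
      change (σ g : Multiplicative (ℚ × ℚ) → Multiplicative (ℚ × ℚ)) '' {ofAdd ((k : ℚ), (1 : ℚ))}
        = ({ofAdd ((((k + toAdd g : ℤ)) : ℚ), (1 : ℚ))} : Set (Multiplicative (ℚ × ℚ)))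
      rw [Set.image_singleton]
      congr 1
      apply toAdd.injective
      rw [hσ, toAdd_ofAdd, toAdd_ofAdd]
      ext <;> simp
    · -- the divisor map kills the units
      intro u hu
      exact hu
    · -- and is `> 1` on every root of every theta class
      rintro k t ⟨N, hN, ht⟩
      change (1 : Multiplicative ℚ) < v t
      rw [← ofAdd_toAdd (v t), hv, ht, ← ofAdd_zero, ofAdd_lt]
      positivity
  · -- every theta class `θ_k = (k, 1)` is non-torsion: its order (2nd coordinate) is `1`
    intro k
    refine ⟨(ofAdd ((k : ℚ), (1 : ℚ)) : Multiplicative (ℚ × ℚ)), Set.mem_singleton _, ?_⟩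
    intro ht
    have h2 : IsOfFinOrder (v (ofAdd ((k : ℚ), (1 : ℚ)))) := v.isOfFinOrder ht
    have h3 : v (ofAdd ((k : ℚ), (1 : ℚ))) = ofAdd (1 : ℚ) := rfl
    rw [h3, isOfFinOrder_iff_pow_eq_one] at h2
    obtain ⟨n, hn, h⟩ := h2
    rw [← ofAdd_nsmul, ofAdd_eq_one] at h
    simp at h
    omega
  · -- the action moves `θ_0` to `θ_1 ≠ θ_0`
    refine ⟨ofAdd 1, (0 : ℤ), ?_⟩
    intro h
    have hmem : (ofAdd ((1 : ℚ), (1 : ℚ)) : Multiplicative (ℚ × ℚ)) ∈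
        (σ (ofAdd 1) : Multiplicative (ℚ × ℚ) → Multiplicative (ℚ × ℚ)) ''
          ({ofAdd (((0 : ℤ) : ℚ), (1 : ℚ))} : Set (Multiplicative (ℚ × ℚ))) := by
      refine ⟨ofAdd (((0 : ℤ) : ℚ), (1 : ℚ)), Set.mem_singleton _, ?_⟩
      apply toAdd.injective
      simp [hσ]
    have hc : (σ (ofAdd 1) : Multiplicative (ℚ × ℚ) → Multiplicative (ℚ × ℚ)) ''
          ({ofAdd (((0 : ℤ) : ℚ), (1 : ℚ))} : Set (Multiplicative (ℚ × ℚ)))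
        = ({ofAdd (((0 : ℤ) : ℚ), (1 : ℚ))} : Set (Multiplicative (ℚ × ℚ))) := h
    rw [hc] at hmem
    have := congrArg (fun z : Multiplicative (ℚ × ℚ) => (toAdd z).1) (Set.mem_singleton_iff.mp hmem)
    simp at this
  · -- the unit `(1, 0)` is non-torsion: its "unit part" (1st coordinate) is `1`
    refine ⟨(ofAdd ((1 : ℚ), (0 : ℚ)) : Multiplicative (ℚ × ℚ)), ?_, ?_⟩
    · show v (ofAdd ((1 : ℚ), (0 : ℚ))) = 1
      rfl
    · intro hu
      have h2 : IsOfFinOrder (w (ofAdd ((1 : ℚ), (0 : ℚ)))) := w.isOfFinOrder hu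
      have h3 : w (ofAdd ((1 : ℚ), (0 : ℚ))) = ofAdd (1 : ℚ) := rfl
      rw [h3, isOfFinOrder_iff_pow_eq_one] at h2
      obtain ⟨n, hn, h⟩ := h2
      rw [← ofAdd_nsmul, ofAdd_eq_one] at h
      simp at h
      omega

/-- **IUTchII:Ex3.2(i)**/(ii) (kurims pp.88–89) NON-VACUITY WITNESS: there is a
`TemperedFrobenioidThetaData` (same toy: `ℤ` acting on `ℚ × ℚ` by shears, units `ℚ × 0`, `Θ := (0, 1)`,
base monoid `{order ≥ 0}`) for which `Example32Statements` HOLDS while `Θ` is NON-torsion, is MOVED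
by the action (`Θ ↦ (n, 1)`), and non-torsion units exist — so "characteristic splittings up to
torsion … compatible with the action of `Π_v`" and the stability clauses are jointly satisfiable by
non-degenerate data. [cite: Mochizuki2012, Ex 3.2 (i) p.88] -/
theorem example32Statements_witness :
    ∃ F : TemperedFrobenioidThetaData.{0, 0} (Multiplicative ℤ),
      Example32Statements F ∧ ¬ IsOfFinOrder F.theta ∧
      (∃ g : Multiplicative ℤ, F.conj g F.theta ≠ F.theta) ∧
      (∃ u ∈ F.units, ¬ IsOfFinOrder u) := by
  obtain ⟨σ, hσ⟩ := exists_shear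
  let v : Multiplicative (ℚ × ℚ) →* Multiplicative ℚ := (AddMonoidHom.snd ℚ ℚ).toMultiplicative
  let w : Multiplicative (ℚ × ℚ) →* Multiplicative ℚ := (AddMonoidHom.fst ℚ ℚ).toMultiplicative
  have hv : ∀ x : Multiplicative (ℚ × ℚ), toAdd (v x) = (toAdd x).2 := fun _ => rfl
  have hσ2 : ∀ (g : Multiplicative ℤ) (x : Multiplicative (ℚ × ℚ)), (toAdd (σ g x)).2 = (toAdd x).2 :=
    fun g x => by rw [hσ g x]
  let C : Submonoid (Multiplicative (ℚ × ℚ)) :=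
    { carrier := {x | 0 ≤ (toAdd x).2}
      one_mem' := by simp
      mul_mem' := fun {x y} hx hy => by
        simp only [Set.mem_setOf_eq, toAdd_mul, Prod.snd_add] at hx hy ⊢
        linarith }
  refine ⟨{ K := CommGrpCat.of (Multiplicative (ℚ × ℚ))
            conj := σ
            units := v.ker
            theta := (ofAdd ((0 : ℚ), (1 : ℚ)) : Multiplicative (ℚ × ℚ))
            baseMonoid := C }, ?_, ?_, ?_, ?_⟩
  · refine example32Statements_of_val _ (Γ := Multiplicative ℚ) ?_ ?_ v ?_ ?_
    · -- units are stable: shears preserve the order (`= 0`)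
      intro g x hx
      have hx' : (toAdd (x : Multiplicative (ℚ × ℚ))).2 = 0 := by
        have h0 : v x = 1 := hx
        rwa [← toAdd.injective.eq_iff, hv, toAdd_one] at h0
      change v (σ g x) = 1
      rw [← toAdd.injective.eq_iff, hv, toAdd_one, hσ2]
      exact hx'
    · -- the base monoid is stable
      intro g x hx
      change 0 ≤ (toAdd (σ g x)).2
      rw [hσ2]
      exact hx
    · intro u hu
      exact hu
    · change (1 : Multiplicative ℚ) < v (ofAdd ((0 : ℚ), (1 : ℚ)))
      have h3 : v (ofAdd ((0 : ℚ), (1 : ℚ))) = ofAdd (1 : ℚ) := rfl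
      rw [h3, ← ofAdd_zero, ofAdd_lt]
      norm_num
  · -- `Θ = (0, 1)` is non-torsion
    intro ht
    have h2 : IsOfFinOrder (v (ofAdd ((0 : ℚ), (1 : ℚ)))) := v.isOfFinOrder ht
    have h3 : v (ofAdd ((0 : ℚ), (1 : ℚ))) = ofAdd (1 : ℚ) := rfl
    rw [h3, isOfFinOrder_iff_pow_eq_one] at h2
    obtain ⟨n, hn, h⟩ := h2
    rw [← ofAdd_nsmul, ofAdd_eq_one] at h
    simp at h
    omega
  · -- the action moves `Θ`: `1 · (0, 1) = (1, 1)`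
    refine ⟨ofAdd 1, ?_⟩
    intro h
    have := congrArg (fun z : Multiplicative (ℚ × ℚ) => (toAdd z).1) h
    simp [hσ] at this
  · refine ⟨(ofAdd ((1 : ℚ), (0 : ℚ)) : Multiplicative (ℚ × ℚ)), ?_, ?_⟩
    · show v (ofAdd ((1 : ℚ), (0 : ℚ))) = 1
      rfl
    · intro hu
      have h2 : IsOfFinOrder (w (ofAdd ((1 : ℚ), (0 : ℚ)))) := w.isOfFinOrder hu
      have h3 : w (ofAdd ((1 : ℚ), (0 : ℚ))) = ofAdd (1 : ℚ) := rfl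
      rw [h3, isOfFinOrder_iff_pow_eq_one] at h2
      obtain ⟨n, hn, h⟩ := h2
      rw [← ofAdd_nsmul, ofAdd_eq_one] at h
      simp at h
      omega

end TemperedThetaMonoids

end Literature.IUT.HodgeArakelov
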